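import Summits.KontsevichZagierPeriods.KontsevichZagierPeriods.Theorems.SoloInformedNLFrame
import HarnessLib
import HarnessLib.Audit

/-!
# SoloInformed — both sides of a Newton–Leibniz move as signed sums of unit sheets (Newton–Leibniz elimination, file 4c-ii-d2)

Solo programme `solo-KontsevichZagierPeriods-informed`, session s245 (K-NF, `paper/nl-elimination.md`
§7.2, FILE 4c-ii, assembly part 2).

For a frame `Φ` (file 4c-ii-d1) of a Newton–Leibniz datum `[B, f] - [τ, g]`:

* LEFT.  `soloInformed lhs`: `[B, f] ≡ ∑_{p ∈ IL} εL p · [lSheet p]` modulo `relations₁₂`, where `p`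
  runs over the open bands of the first decomposition inside `B` on which `f` has a sign
  (`εL = +1` on `P`, `-1` on `N`), `lSheet p` is the cell sheet of file 4c-ii-c (domain
  `Ψ_F(band)`, integrand `1`), and the bands in `Z = {f = 0}` are junk (file 589)
  (`SoloInformedNLFrame.lhs_mem`).
* RIGHT.  `[τ × [0,1], g] ≡ ∑_{S ∈ IR} εR S · [rSheet S]`, where `S` runs over the open base cells
  inside `τ` on which `g` has a sign, `rSheet S` is the shear sheet of file 598 of the slab piece
  over `S`, and the null cells and the cells in `{g = 0}` are junk (`SoloInformedNLFrame.rhs_mem`).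

References: this work (THEOREM NF, `paper/nl-elimination.md` §2).
-/

noncomputable section

open scoped BigOperators Topology ContDiff

namespace Summit.KontsevichZagierPeriods.KontsevichZagierPeriods.Theorems

open Set MeasureTheory Filter
open Literature.ModelTheory.ExponentialFields
open Literature.NumberTheory.Transcendental Literature.NumberTheory.Transcendental.KZ

variable {n : ℕ}

namespace SoloInformedNLFrame

variable (Φ : SoloInformedNLFrame n)

/-! ### The left side -/

/-- Admissibility of a band index `p = ⟨S, j⟩`: `S` is a base cell, the band is open and lies in
`B`. -/
def LCond (p : Σ S : Set (Fin n → ℝ), Fin (Φ.lS S + 1)) : Prop :=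
  p.1 ∈ Φ.𝒮 ∧ IsOpen (bandOver p.1 (Φ.ξ p.1) p.2) ∧ bandOver p.1 (Φ.ξ p.1) p.2 ⊆ Φ.r.domain

open Classical in
/-- The left sheet of a band: the positive cell sheet if the band lies in `P`, the negative one
if it lies in `N` (junk value `Φ.r` otherwise). -/
def lSheet (p : Σ S : Set (Fin n → ℝ), Fin (Φ.lS S + 1)) : IntegralRep (n + 1) :=
  if h : Φ.LCond p ∧ bandOver p.1 (Φ.ξ p.1) p.2 ⊆ Φ.P then
    soloInformedCellPosSheet Φ.r Φ.F (bandOver p.1 (Φ.ξ p.1) p.2) Φ.hF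
      (Φ.isSemialgebraic_band h.1.1 p.2) h.1.2.2 h.1.2.1 Φ.hGF.2.1 Φ.hGF.2.2.2.1
      (fun _ hz => (h.2 hz).1) Φ.hdom Φ.hderiv
      (fun x => soloInformed_convex_fibre_bandOver p.1 (Φ.ξ p.1) p.2 x) (fun _ hz => (h.2 hz).2)
  else if h : Φ.LCond p ∧ bandOver p.1 (Φ.ξ p.1) p.2 ⊆ Φ.N then
    soloInformedCellNegSheet Φ.r Φ.F (bandOver p.1 (Φ.ξ p.1) p.2) Φ.hF
      (Φ.isSemialgebraic_band h.1.1 p.2) h.1.2.2 h.1.2.1 Φ.hGF.2.1 Φ.hGF.2.2.2.1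
      (fun _ hz => (h.2 hz).1) Φ.hdom Φ.hderiv
      (fun x => soloInformed_convex_fibre_bandOver p.1 (Φ.ξ p.1) p.2 x) (fun _ hz => (h.2 hz).2)
  else Φ.r

open Classical in
/-- The left sign: `+1` on `P`, `-1` otherwise. -/
def εL (p : Σ S : Set (Fin n → ℝ), Fin (Φ.lS S + 1)) : ℤ :=
  if bandOver p.1 (Φ.ξ p.1) p.2 ⊆ Φ.P then 1 else -1

open Classical in
/-- Band indices over `S` of the bands inside `B`. -/
def JB (S : Set (Fin n → ℝ)) : Finset (Fin (Φ.lS S + 1)) :=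
  Finset.univ.filter fun j => bandOver S (Φ.ξ S) j ⊆ Φ.r.domain

open Classical in
/-- Band indices over `S` of the bands inside `B` with a sign. -/
def JL (S : Set (Fin n → ℝ)) : Finset (Fin (Φ.lS S + 1)) :=
  (Φ.JB S).filter fun j => bandOver S (Φ.ξ S) j ⊆ Φ.P ∨ bandOver S (Φ.ξ S) j ⊆ Φ.N

open Classical in
/-- The left index set: signed open bands inside `B` over open base cells. -/
def IL : Finset (Σ S : Set (Fin n → ℝ), Fin (Φ.lS S + 1)) := (Φ.𝒮.filter IsOpen).sigma Φ.JL

/-- A band piece is equivalent to its signed left sheet. -/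
theorem of_cadRep_sub_smul_lSheet_mem {p : Σ S : Set (Fin n → ℝ), Fin (Φ.lS S + 1)}
    (hc : Φ.LCond p) (hPN : bandOver p.1 (Φ.ξ p.1) p.2 ⊆ Φ.P ∨ bandOver p.1 (Φ.ξ p.1) p.2 ⊆ Φ.N) :
    of (soloInformedCadRep Φ.r (bandOver p.1 (Φ.ξ p.1) p.2)) - Φ.εL p • of (Φ.lSheet p) ∈
      soloInformedEquidimRelations := by
  by_cases hP : bandOver p.1 (Φ.ξ p.1) p.2 ⊆ Φ.P
  · rw [εL, if_pos hP, one_zsmul, lSheet, dif_pos ⟨hc, hP⟩]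
    apply soloInformed_of_cadRep_sub_of_cellPosSheet_mem
  · rw [εL, if_neg hP, neg_one_zsmul, sub_neg_eq_add, lSheet, dif_neg (fun h => hP h.2),
      dif_pos ⟨hc, hPN.resolve_left hP⟩]
    apply soloInformed_of_cadRep_add_of_cellNegSheet_mem

/-- The left sheets have integrand `1`. -/
theorem lSheet_integrand {p : Σ S : Set (Fin n → ℝ), Fin (Φ.lS S + 1)} (hc : Φ.LCond p)
    (hPN : bandOver p.1 (Φ.ξ p.1) p.2 ⊆ Φ.P ∨ bandOver p.1 (Φ.ξ p.1) p.2 ⊆ Φ.N) :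
    (Φ.lSheet p).integrand = fun _ => 1 := by
  by_cases hP : bandOver p.1 (Φ.ξ p.1) p.2 ⊆ Φ.P
  · rw [lSheet, dif_pos ⟨hc, hP⟩]; apply soloInformed_cellPosSheet_integrand
  · rw [lSheet, dif_neg (fun h => hP h.2), dif_pos ⟨hc, hPN.resolve_left hP⟩]
    apply soloInformed_cellNegSheet_integrand

/-- The left sheets have domain `Ψ_F(band)`. -/
theorem lSheet_domain {p : Σ S : Set (Fin n → ℝ), Fin (Φ.lS S + 1)} (hc : Φ.LCond p)
    (hPN : bandOver p.1 (Φ.ξ p.1) p.2 ⊆ Φ.P ∨ bandOver p.1 (Φ.ξ p.1) p.2 ⊆ Φ.N) :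
    (Φ.lSheet p).domain = soloInformedLastSubst Φ.F '' bandOver p.1 (Φ.ξ p.1) p.2 := by
  by_cases hP : bandOver p.1 (Φ.ξ p.1) p.2 ⊆ Φ.P
  · rw [lSheet, dif_pos ⟨hc, hP⟩]; apply soloInformed_cellPosSheet_domain
  · rw [lSheet, dif_neg (fun h => hP h.2), dif_pos ⟨hc, hPN.resolve_left hP⟩]
    apply soloInformed_cellNegSheet_domain

/-- Membership in `JB`. -/
theorem mem_JB {S : Set (Fin n → ℝ)} {j : Fin (Φ.lS S + 1)} :
    j ∈ Φ.JB S ↔ bandOver S (Φ.ξ S) j ⊆ Φ.r.domain := by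
  classical
  simp [JB]

/-- Membership in `JL`. -/
theorem mem_JL {S : Set (Fin n → ℝ)} {j : Fin (Φ.lS S + 1)} :
    j ∈ Φ.JL S ↔ bandOver S (Φ.ξ S) j ⊆ Φ.r.domain ∧
      (bandOver S (Φ.ξ S) j ⊆ Φ.P ∨ bandOver S (Φ.ξ S) j ⊆ Φ.N) := by
  classical
  simp [JL, JB]

/-- Membership in `IL`. -/
theorem mem_IL {p : Σ S : Set (Fin n → ℝ), Fin (Φ.lS S + 1)} :
    p ∈ Φ.IL ↔ (p.1 ∈ Φ.𝒮 ∧ IsOpen p.1) ∧ bandOver p.1 (Φ.ξ p.1) p.2 ⊆ Φ.r.domain ∧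
      (bandOver p.1 (Φ.ξ p.1) p.2 ⊆ Φ.P ∨ bandOver p.1 (Φ.ξ p.1) p.2 ⊆ Φ.N) := by
  classical
  simp [IL, JL, JB, Finset.mem_sigma]

/-- Indices in `IL` are admissible. -/
theorem lCond_of_mem_IL {p : Σ S : Set (Fin n → ℝ), Fin (Φ.lS S + 1)} (hp : p ∈ Φ.IL) :
    Φ.LCond p :=
  ⟨(Φ.mem_IL.1 hp).1.1, soloInformed_isOpen_bandOver (Φ.mem_IL.1 hp).1.2
    (Φ.hcontξ p.1 (Φ.mem_IL.1 hp).1.1) p.2, (Φ.mem_IL.1 hp).2.1⟩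

/-- An open band inside `B` without sign lies in `Z`, so its piece is junk. -/
theorem of_cadRep_mem_of_not_signed {S : Set (Fin n → ℝ)} (hS : S ∈ Φ.𝒮) (hSo : IsOpen S)
    {j : Fin (Φ.lS S + 1)} (hB : bandOver S (Φ.ξ S) j ⊆ Φ.r.domain)
    (hPN : ¬ (bandOver S (Φ.ξ S) j ⊆ Φ.P ∨ bandOver S (Φ.ξ S) j ⊆ Φ.N)) :
    of (soloInformedCadRep Φ.r (bandOver S (Φ.ξ S) j)) ∈ soloInformedEquidimRelations := by
  have hBo := soloInformed_isOpen_bandOver hSo (Φ.hcontξ S hS) j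
  have hZ : bandOver S (Φ.ξ S) j ⊆ Φ.Z := by
    rcases Φ.band_trichotomy hS hBo hB with h | h | h
    · exact absurd (Or.inl h) hPN
    · exact absurd (Or.inr h) hPN
    · exact h
  refine soloInformed_of_mem_equidimRelations_of_eqOn_zero _ fun z hz => ?_
  rw [soloInformed_cadRep_domain Φ.r (Φ.isSemialgebraic_band hS j) hB] at hz
  simp only [soloInformed_cadRep_integrand, Pi.zero_apply]
  exact (hZ hz).2

open Classical in
/-- **Left reduction**: `[B, f] ≡ ∑_{p ∈ IL} εL p · [lSheet p]` modulo `relations₁₂`. -/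
theorem lhs_mem :
    of Φ.r - ∑ p ∈ Φ.IL, Φ.εL p • of (Φ.lSheet p) ∈ soloInformedEquidimRelations := by
  obtain ⟨𝒞B, h𝒞B, hUB⟩ := Φ.adB
  have h1 := soloInformed_of_sub_sum_openCells_mem Φ.h𝒯 Φ.r h𝒞B hUB
  rw [soloInformed_sum_openCells_eq_sum_bands Φ.h𝒯 Φ.h𝒮 Φ.hcontξ Φ.hsaξ Φ.hmono Φ.hmem h𝒞B hUB
    (fun C => of (soloInformedCadRep Φ.r C))] at h1
  have h2 : (∑ S ∈ Φ.𝒮.filter IsOpen, ∑ j ∈ Φ.JB S, of (soloInformedCadRep Φ.r (bandOver S (Φ.ξ S) j))) -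
      ∑ p ∈ Φ.IL, Φ.εL p • of (Φ.lSheet p) ∈ soloInformedEquidimRelations := by
    rw [IL, Finset.sum_sigma, ← Finset.sum_sub_distrib]
    refine AddSubgroup.sum_mem _ fun S hS => ?_
    obtain ⟨hS𝒮, hSo⟩ := Finset.mem_filter.1 hS
    rw [← Finset.sum_filter_add_sum_filter_not (Φ.JB S)
      (fun j => bandOver S (Φ.ξ S) j ⊆ Φ.P ∨ bandOver S (Φ.ξ S) j ⊆ Φ.N), add_sub_right_comm]
    refine add_mem ?_ (AddSubgroup.sum_mem _ fun j hj => ?_)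
    · rw [show ((Φ.JB S).filter fun j => bandOver S (Φ.ξ S) j ⊆ Φ.P ∨ bandOver S (Φ.ξ S) j ⊆ Φ.N) =
          Φ.JL S from rfl, ← Finset.sum_sub_distrib]
      refine AddSubgroup.sum_mem _ fun j hj => ?_
      obtain ⟨hB, hPN⟩ := Φ.mem_JL.1 hj
      exact Φ.of_cadRep_sub_smul_lSheet_mem
        ⟨hS𝒮, soloInformed_isOpen_bandOver hSo (Φ.hcontξ S hS𝒮) j, hB⟩ hPN
    · obtain ⟨hjB, hPN⟩ := Finset.mem_filter.1 hj
      exact Φ.of_cadRep_mem_of_not_signed hS𝒮 hSo (Φ.mem_JB.1 hjB) hPN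
  have h3 := add_mem h1 h2
  rwa [show Φ.JB = fun S => Finset.univ.filter fun j : Fin (Φ.lS S + 1) =>
      bandOver S (Φ.ξ S) j ⊆ Φ.r.domain from rfl, sub_add_sub_cancel] at h3

/-! ### The right side -/

/-- The slab `S × [0,1]` is `ℚ`-semialgebraic. -/
theorem isSemialgebraic_slab {S : Set (Fin n → ℝ)} (hS : IsSemialgebraic ℚ S) :
    IsSemialgebraic ℚ (KZlog.band S (fun _ => (0 : ℝ)) (fun _ => 1)) :=
  KZlog.isSemialgebraic_band
    ((isSemialgebraicFunOn_aeval hS (0 : MvPolynomial (Fin n) ℚ)).congr fun _ _ => by simp)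
    ((isSemialgebraicFunOn_aeval hS (1 : MvPolynomial (Fin n) ℚ)).congr fun _ _ => by simp)

/-- The integrand of the flattening is `g ∘ init`. -/
theorem flat_integrand_eq (z : Fin (n + 1) → ℝ) :
    (soloInformedFlat Φ.r').integrand z = Φ.r'.integrand (Fin.init z) := by
  conv_lhs => rw [← Fin.snoc_init_self z]
  exact soloInformed_flat_integrand_snoc _ _ _

/-- The slab over a subset of `τ` lies in the flattened domain. -/
theorem slab_subset {S : Set (Fin n → ℝ)} (hSτ : S ⊆ Φ.r'.domain) :
    KZlog.band S (fun _ => (0 : ℝ)) (fun _ => 1) ⊆ (soloInformedFlat Φ.r').domain := by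
  intro z hz
  rw [soloInformed_flat_domain]
  exact ⟨hSτ hz.1, hz.2.1, hz.2.2⟩

/-- The slab piece of the flattening over `S`. -/
def slabRep (S : Set (Fin n → ℝ)) : IntegralRep (n + 1) :=
  soloInformedCadRep (soloInformedFlat Φ.r') (KZlog.band S (fun _ => (0 : ℝ)) (fun _ => 1))

/-- Domain of a slab piece. -/
theorem slabRep_domain {S : Set (Fin n → ℝ)} (hS : S ∈ Φ.𝒮) (hSτ : S ⊆ Φ.r'.domain) :
    (Φ.slabRep S).domain = KZlog.band S (fun _ => (0 : ℝ)) (fun _ => 1) :=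
  soloInformed_cadRep_domain _ (isSemialgebraic_slab (Φ.h𝒮.isSemialgebraic S hS)) (Φ.slab_subset hSτ)

/-- Integrand of a slab piece. -/
theorem slabRep_integrand (S : Set (Fin n → ℝ)) :
    ∀ z ∈ (Φ.slabRep S).domain, (Φ.slabRep S).integrand z = Φ.r'.integrand (Fin.init z) :=
  fun z _ => by rw [slabRep, soloInformed_cadRep_integrand, flat_integrand_eq]

/-- Admissibility of a base cell: it is an open cell inside `τ`. -/
def RCond (S : Set (Fin n → ℝ)) : Prop := S ∈ Φ.𝒮 ∧ IsOpen S ∧ S ⊆ Φ.r'.domain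

open Classical in
/-- The right sheet of a base cell: the positive shear sheet of its slab piece if the cell lies in
`τ⁺`, the negative one if it lies in `τ⁻` (junk value `Φ.r` otherwise). -/
def rSheet (S : Set (Fin n → ℝ)) : IntegralRep (n + 1) :=
  if h : Φ.RCond S ∧ S ⊆ Φ.τp then
    soloInformedPosShearSheet (Φ.slabRep S) S (fun x => Φ.F (Fin.snoc x (Φ.a x))) Φ.r'.integrand
      (Φ.h𝒮.isSemialgebraic S h.1.1) h.1.2.1
      (Φ.isSemialgebraicFunOn_ha.mono h.1.2.2 (Φ.h𝒮.isSemialgebraic S h.1.1))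
      (Φ.r'.isSemialgebraicFunOn_integrand.mono h.1.2.2 (Φ.h𝒮.isSemialgebraic S h.1.1))
      (Φ.hGh.2.2.2.1.mono fun _ hx => (h.2 hx).1.2) (Φ.hGg.2.2.2.1.mono fun _ hx => (h.2 hx).1.1)
      (Φ.slabRep_domain h.1.1 h.1.2.2) (Φ.slabRep_integrand S) (fun _ hx => (h.2 hx).2)
  else if h : Φ.RCond S ∧ S ⊆ Φ.τm then
    soloInformedNegShearSheet (Φ.slabRep S) S (fun x => Φ.F (Fin.snoc x (Φ.a x))) Φ.r'.integrand
      (Φ.h𝒮.isSemialgebraic S h.1.1) h.1.2.1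
      (Φ.isSemialgebraicFunOn_ha.mono h.1.2.2 (Φ.h𝒮.isSemialgebraic S h.1.1))
      (Φ.r'.isSemialgebraicFunOn_integrand.mono h.1.2.2 (Φ.h𝒮.isSemialgebraic S h.1.1))
      (Φ.hGh.2.2.2.1.mono fun _ hx => (h.2 hx).1.2) (Φ.hGg.2.2.2.1.mono fun _ hx => (h.2 hx).1.1)
      (Φ.slabRep_domain h.1.1 h.1.2.2) (Φ.slabRep_integrand S) (fun _ hx => (h.2 hx).2)
  else Φ.r

open Classical in
/-- The right sign: `+1` on `τ⁺`, `-1` otherwise. -/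
def εR (S : Set (Fin n → ℝ)) : ℤ := if S ⊆ Φ.τp then 1 else -1

open Classical in
/-- The base cells inside `τ`. -/
def Sτ : Finset (Set (Fin n → ℝ)) := Φ.𝒮.filter fun S => S ⊆ Φ.r'.domain

open Classical in
/-- The right index set: open base cells inside `τ` with a sign. -/
def IR : Finset (Set (Fin n → ℝ)) := Φ.Sτ.filter fun S => IsOpen S ∧ (S ⊆ Φ.τp ∨ S ⊆ Φ.τm)

/-- Membership in `IR`. -/
theorem mem_IR {S : Set (Fin n → ℝ)} :
    S ∈ Φ.IR ↔ (S ∈ Φ.𝒮 ∧ S ⊆ Φ.r'.domain) ∧ IsOpen S ∧ (S ⊆ Φ.τp ∨ S ⊆ Φ.τm) := by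
  classical
  simp [IR, Sτ]

/-- A slab piece over a signed open cell is equivalent to its signed right sheet. -/
theorem of_slabRep_sub_smul_rSheet_mem {S : Set (Fin n → ℝ)} (hc : Φ.RCond S)
    (hpm : S ⊆ Φ.τp ∨ S ⊆ Φ.τm) :
    of (Φ.slabRep S) - Φ.εR S • of (Φ.rSheet S) ∈ soloInformedEquidimRelations := by
  by_cases hp : S ⊆ Φ.τp
  · rw [εR, if_pos hp, one_zsmul, rSheet, dif_pos ⟨hc, hp⟩]
    apply soloInformed_of_sub_of_posShearSheet_mem
  · rw [εR, if_neg hp, neg_one_zsmul, sub_neg_eq_add, rSheet, dif_neg (fun h => hp h.2),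
      dif_pos ⟨hc, hpm.resolve_left hp⟩]
    apply soloInformed_of_add_of_negShearSheet_mem

/-- The right sheets have integrand `1`. -/
theorem rSheet_integrand {S : Set (Fin n → ℝ)} (hc : Φ.RCond S) (hpm : S ⊆ Φ.τp ∨ S ⊆ Φ.τm) :
    (Φ.rSheet S).integrand = fun _ => 1 := by
  by_cases hp : S ⊆ Φ.τp
  · rw [rSheet, dif_pos ⟨hc, hp⟩]; apply soloInformed_posShearSheet_integrand
  · rw [rSheet, dif_neg (fun h => hp h.2), dif_pos ⟨hc, hpm.resolve_left hp⟩]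
    apply soloInformed_negShearSheet_integrand

/-- The right sheets have domain `Ψ_G(slab)` for the shear `G`. -/
theorem rSheet_domain {S : Set (Fin n → ℝ)} (hc : Φ.RCond S) (hpm : S ⊆ Φ.τp ∨ S ⊆ Φ.τm) :
    (Φ.rSheet S).domain = soloInformedLastSubst
      (soloInformedShear (fun x => Φ.F (Fin.snoc x (Φ.a x))) Φ.r'.integrand) '' (Φ.slabRep S).domain := by
  by_cases hp : S ⊆ Φ.τp
  · rw [rSheet, dif_pos ⟨hc, hp⟩]; apply soloInformed_posShearSheet_domain
  · rw [rSheet, dif_neg (fun h => hp h.2), dif_pos ⟨hc, hpm.resolve_left hp⟩]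
    apply soloInformed_negShearSheet_domain

/-- **The flattening splits over the base cells inside `τ`.** -/
theorem of_flat_sub_sum_slabRep_mem :
    of (soloInformedFlat Φ.r') - ∑ S ∈ Φ.Sτ, of (Φ.slabRep S) ∈ soloInformedEquidimRelations := by
  classical
  refine soloInformed_of_sub_sum_of_mem_equidimRelations Φ.Sτ Φ.slabRep (soloInformedFlat Φ.r')
    ?_ (fun S _ z hz => ((Φ.slabRep_integrand S z hz).trans (Φ.flat_integrand_eq z).symm).symm) ?_
  · ext z
    simp only [mem_iUnion]
    constructor
    · intro hz
      have hz' := hz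
      rw [soloInformed_flat_domain] at hz'
      obtain ⟨S, ⟨hS𝒮', hxS⟩, -⟩ := Φ.hpartS.2 (Fin.init z)
      have hS𝒮 : S ∈ Φ.𝒮 := Finset.mem_coe.1 hS𝒮'
      have hSτ := Φ.base_subset_of_mem hS𝒮 hxS hz'.1
      refine ⟨S, by simp [Sτ, hS𝒮, hSτ], ?_⟩
      rw [Φ.slabRep_domain hS𝒮 hSτ]
      exact ⟨hxS, hz'.2.1, hz'.2.2⟩
    · rintro ⟨S, hS, hz⟩
      obtain ⟨hS𝒮, hSτ⟩ : S ∈ Φ.𝒮 ∧ S ⊆ Φ.r'.domain := by simpa [Sτ] using hS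
      rw [Φ.slabRep_domain hS𝒮 hSτ] at hz
      exact Φ.slab_subset hSτ hz
  · intro S hS S' hS' hne
    obtain ⟨hS𝒮, hSτ⟩ : S ∈ Φ.𝒮 ∧ S ⊆ Φ.r'.domain := by simpa [Sτ] using hS
    obtain ⟨hS'𝒮, hS'τ⟩ : S' ∈ Φ.𝒮 ∧ S' ⊆ Φ.r'.domain := by simpa [Sτ] using hS'
    rw [Φ.slabRep_domain hS𝒮 hSτ, Φ.slabRep_domain hS'𝒮 hS'τ]
    suffices h : KZlog.band S (fun _ => (0 : ℝ)) (fun _ => 1) ∩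
        KZlog.band S' (fun _ => (0 : ℝ)) (fun _ => 1) = ∅ by rw [h, measure_empty]
    refine Set.eq_empty_iff_forall_notMem.2 fun z hz => hne ?_
    obtain ⟨T, -, huniq⟩ := Φ.hpartS.2 (Fin.init z)
    exact (huniq S ⟨Finset.mem_coe.2 hS𝒮, hz.1.1⟩).trans
      (huniq S' ⟨Finset.mem_coe.2 hS'𝒮, hz.2.1⟩).symm

/-- A slab piece over a non-signed cell is junk: the cell is null or lies in `{g = 0}`. -/
theorem of_slabRep_mem_of_not_signed {S : Set (Fin n → ℝ)} (hS : S ∈ Φ.𝒮)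
    (hSτ : S ⊆ Φ.r'.domain) (hno : ¬ (IsOpen S ∧ (S ⊆ Φ.τp ∨ S ⊆ Φ.τm))) :
    of (Φ.slabRep S) ∈ soloInformedEquidimRelations := by
  by_cases hSo : IsOpen S
  · have h0 : S ⊆ Φ.τ0 := by
      rcases Φ.base_trichotomy hS hSo hSτ with h | h | h
      · exact absurd ⟨hSo, Or.inl h⟩ hno
      · exact absurd ⟨hSo, Or.inr h⟩ hno
      · exact h
    refine soloInformed_of_mem_equidimRelations_of_eqOn_zero _ fun z hz => ?_
    rw [Φ.slabRep_integrand S z hz, Pi.zero_apply]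
    rw [Φ.slabRep_domain hS hSτ] at hz
    exact (h0 hz.1).2
  · have hnull : volume S = 0 :=
      (soloInformed_cad_isOpen_or_volume_eq_zero n Φ.𝒮 Φ.h𝒮 S hS).resolve_left hSo
    refine soloInformed_of_mem_equidimRelations_of_volume_eq_zero _ ?_
    rw [Φ.slabRep_domain hS hSτ]
    exact measure_mono_null (fun z hz => hz.1) (volume_setOf_init_mem_eq_zero hnull)

open Classical in
/-- **Right reduction**: `[τ × [0,1], g] ≡ ∑_{S ∈ IR} εR S · [rSheet S]` modulo `relations₁₂`. -/
theorem rhs_mem :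
    of (soloInformedFlat Φ.r') - ∑ S ∈ Φ.IR, Φ.εR S • of (Φ.rSheet S) ∈
      soloInformedEquidimRelations := by
  have h1 := Φ.of_flat_sub_sum_slabRep_mem
  have h2 : ∑ S ∈ Φ.Sτ, of (Φ.slabRep S) - ∑ S ∈ Φ.IR, Φ.εR S • of (Φ.rSheet S) ∈
      soloInformedEquidimRelations := by
    rw [IR, ← Finset.sum_filter_add_sum_filter_not Φ.Sτ
      (fun S => IsOpen S ∧ (S ⊆ Φ.τp ∨ S ⊆ Φ.τm)), add_sub_right_comm, ← Finset.sum_sub_distrib]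
    refine add_mem (AddSubgroup.sum_mem _ fun S hS => ?_) (AddSubgroup.sum_mem _ fun S hS => ?_)
    · obtain ⟨hS1, hSo, hpm⟩ := Finset.mem_filter.1 hS
      obtain ⟨hS𝒮, hSτ⟩ : S ∈ Φ.𝒮 ∧ S ⊆ Φ.r'.domain := by simpa [Sτ] using hS1
      exact Φ.of_slabRep_sub_smul_rSheet_mem ⟨hS𝒮, hSo, hSτ⟩ hpm
    · obtain ⟨hS1, hno⟩ := Finset.mem_filter.1 hS
      obtain ⟨hS𝒮, hSτ⟩ : S ∈ Φ.𝒮 ∧ S ⊆ Φ.r'.domain := by simpa [Sτ] using hS1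
      exact Φ.of_slabRep_mem_of_not_signed hS𝒮 hSτ hno
  have h3 := add_mem h1 h2
  rwa [sub_add_sub_cancel] at h3

end SoloInformedNLFrame

end Summit.KontsevichZagierPeriods.KontsevichZagierPeriods.Theorems
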